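import Literature.NumberTheory.EllipticCurves.Kobayashi2003.FineSelmerLeSignedSelmerProofs
import Literature.NumberTheory.EllipticCurves.Kobayashi2003.SignedSelmerDualUniquenessProofs
import Literature.NumberTheory.EllipticCurves.KatoFineSelmerDualProofs
import Literature.NumberTheory.EllipticCurves.IwasawaAlgebraDivisibilityProofs
import Summits.BirchSwinnertonDyer.BirchSwinnertonDyer.Theorems.ByReductionTypeAtTwoOrdIsogenyDualMaps
import Mathlib.Algebra.Module.CharacterModule
import HarnessLib

/-!
# Route `ThetaPartnerAtTwo` (TP2), crux K3 `SignedKatoDivisibilityUpToAtTwo` (item stmt-BirchSwinnertonDyer-20308),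
# line `colemanrat` v3 — the (PT) SELMER SIDE ON THE PINNED DUALS: the `Λ`-linear restriction
# `k : X^ε(E/K_∞) ↠ X₀(E/K_∞)` dual to `Sel₀(K_∞, E[p^∞]) ≤ Sel^ε(E/K_∞)`, for ANY pinned data
# `D : SignedSelmerDualData W κ γ ε`, `Y : W.FineSelmerDualData κ γ` (any number field `K`, prime `p`, `ℤ_p`-extension
# `κ`, topological generator `γ`, sign `ε`): existence, uniqueness, SURJECTIVITY, kernel, length bookkeeping

Width seat `bsd-wall-tp2-p2x-w3` g2 (cell `bsd-wall`). HONEST FRAMING: THEOREMS ONLY — no definition, no named fact, no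
instance, no `sorry`; route-independent (no `Theses` import); closes no item; BSD is NOT proved by any of this.

## Why this file

K3 is Kato's divisibility through Kobayashi's `+` Coleman map at `p = 2`, in the tree's certified shape «for every pinned
dual datum `D` of `Sel⁺(E/ℚ_∞)` and every height-one `𝔭 ∌ 2`: `ℓ_𝔭(X⁺) + ℓ_𝔭(𝐇¹/Λs) ≤ ℓ_𝔭(X₀) + ℓ_𝔭(Λ/(L♭))`»
(line `colemanrat`, `…OffTwoRoad`), obtained from a Coleman–Poitou–Tate package by the four-term inequality
`SignedKatoOffTwo.fourTerm_lengthAt_le_upTo` (`…OffTwoRobust`), whose global datum is a pair of `Λ`-linear maps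
`j : P → X⁺`, `k : X⁺ → X₀` with «cover: `ker k ⊆ range j` (up to `2^m`)» — Kobayashi's (7.17)/(7.21)
`H¹(k_n,T)/H¹_± → X^±(E/K_n) → X₀(E/K_n) → 0`. The map `k` is the Pontryagin dual of the INCLUSION of the fine Selmer
group in the signed one, which the tree PROVES (`Kobayashi2003.fineSelmerInfty_le_signedSelmerInfty`, any `K`, `p`,
`ε`). This file builds `k` ON THE PINNED INTERFACES of K3 (`SignedSelmerDualData.toDual`, `FineSelmerDualData.toDual`,
whose `Λ`-actions are forced: `SignedSelmerDualData.toDual_smul` and §1 below), proves it is ONTO (divisibility of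
`ℚ/ℤ`: Mathlib's `CharacterModule.dual_surjective_of_injective`), identifies its kernel with the characters of
`Sel^ε(E/K_∞)` vanishing on `Sel₀(K_∞, E[p^∞])` — the Pontryagin dual of `Sel^ε/Sel₀`, the group the local condition
at `p` controls — and records the length bookkeeping `ℓ_𝔭(X^ε) = ℓ_𝔭(ker k) + ℓ_𝔭(X₀)`; in particular `X₀` is
`Λ`-torsion whenever `X^ε` is (K3's torsion hypothesis on `D.X` covers `Y.X` for free). What is NOT here: the map
`j` and the local module `P` (they need the `±` Coleman functional / local Kummer quotient at `p`), reciprocity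
(Poitou–Tate), and the converse inclusion «`Sel^ε ∩ (locally trivial at p) ≤ Sel₀`».

## What is proved (`Λ = IwasawaAlgebra p = ℤ_p⟦T⟧`; `ι₀ = AddSubgroup.inclusion (fineSelmerInfty_le_signedSelmerInfty W κ ε)`)

* §1 `fineDual_toDual_smul` — the `Λ`-action of ANY `Y : W.FineSelmerDualData κ γ` read through `Y.toDual` is the
  canonical one (`IwasawaDual.IsLocNil.smulFun` of `conj_γ − 1` on `Sel₀`), the fine copy of
  `SelmerDualData.toDual_smul` / `SignedSelmerDualData.toDual_smul`.
* §2 `inclusion_conjFineSelmerInfty` — `ι₀` intertwines `conj_γ` on `Sel₀` and on `Sel^ε`.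
* §3 `exists_fineRestrict` — **there is a `Λ`-LINEAR `k : D.X → Y.X` with `Y.toDual (k x) = (D.toDual x) ∘ ι₀`**;
  `fineRestrict_unique`.
* §4 for any such `k`: `fineRestrict_surjective` (**onto**), `fineRestrict_eq_zero_iff` (**`k x = 0 ↔ D.toDual x`
  vanishes on `Sel₀`**), `lengthAt_eq_lengthAt_ker_fineRestrict_add` (**`ℓ_𝔭(D.X) = ℓ_𝔭(ker k) + ℓ_𝔭(Y.X)`**, every
  prime `𝔭` of `Λ`), `lengthAt_fine_le_lengthAt_signed`, `isTorsion_fine_of_isTorsion_signed`.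
* §5 `exists_fineRestrict_package` — the four facts in one `∃ k` statement, the shape consumed as the `k` of
  `fourTerm_lengthAt_le_upTo`.

References: [Kobayashi2003] S. Kobayashi, Invent. Math. 152 (2003), Def. 1.1 (p. 2), (7.17)–(7.21) and Thm. 7.3 (pp.
12–13); [GreenbergLNM1716] R. Greenberg, LNM 1716 (1999), §1 (p. 60: the `Λ`-module structure of Pontryagin duals);
[CoatesSujatha2005] J. Coates, R. Sujatha, Math. Ann. 331 (2005), §3 (fine ⊆ every Selmer); [Washington1997] §13.2.
-/

set_option autoImplicit false
-- the Theorems namespace of this sub repeats the summit name by design (D-0017 nested layout)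
set_option linter.dupNamespace false

noncomputable section

open scoped Classical

namespace Summit.BirchSwinnertonDyer.BirchSwinnertonDyer.Theorems

namespace SignedKatoOffTwo.FineRestriction

open WeierstrassCurve Literature.NumberTheory.EllipticCurves Literature.NumberTheory.EllipticCurves.Kobayashi2003
  Literature.NumberTheory.EllipticCurves.IwasawaDual Literature.NumberTheory.EllipticCurves.Module
  Literature.NumberTheory.GaloisRepresentations ZpExtension
  Summit.BirchSwinnertonDyer.BirchSwinnertonDyer.Theorems.IsogenyMuShift

universe u

variable {K : Type u} [Field K] [NumberField K] (W : WeierstrassCurve K) {p : ℕ} [Fact p.Prime]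
  (κ : ZpExtension K p) {γ : Field.absoluteGaloisGroup K} (ε : ℤˣ)

/-! ## §1 The `Λ`-action of a `FineSelmerDualData` is forced -/

/-- Induction carrier for `fineDual_toDual_smul`: on classes `s ∈ Sel₀(K_∞)` killed by `ψ^N`, `ψ = conj_γ − 1`, the
action of ANY `W.FineSelmerDualData κ γ` read through `toDual` is the canonical finite sum `IsLocNil.smulFun`
(peel off the constant term `f = T·g + C a`; fine copy of `SelmerDualData.toDual_smul_apply_of_pow_apply_eq_zero`).
[cite: GreenbergLNM1716, §1 (after Conj. 1.3)] -/
theorem fineDual_toDual_smul_apply_of_pow_apply_eq_zero (hγ : κ.IsTopGenerator γ) (Y : W.FineSelmerDualData κ γ)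
    (N : ℕ) :
    ∀ (s : W.fineSelmerInfty κ), ((W.conjFineSelmerInfty κ γ - 1) ^ N) s = 0 →
      ∀ (f : IwasawaAlgebra p) (x : Y.X),
        Y.toDual (f • x) s = (W.isLocNil_conjFineSelmerInfty_sub_one κ hγ).smulFun f (Y.toDual x) s := by
  set h := W.isLocNil_conjFineSelmerInfty_sub_one κ hγ
  set ψ : AddMonoid.End (W.fineSelmerInfty κ) := W.conjFineSelmerInfty κ γ - 1 with hψ
  induction N with
  | zero =>
    intro s hs f x
    rw [pow_zero, AddMonoid.End.one_apply] at hs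
    rw [hs, map_zero, map_zero]
  | succ N ih =>
    intro s hs f x
    obtain ⟨k, hk⟩ := h.torsion s
    have hψs : (ψ ^ N) (ψ s) = 0 := by
      rwa [pow_succ, AddMonoid.End.coe_mul, Function.comp_apply] at hs
    have hψeval : ∀ y : Y.X, Y.toDual y (ψ s) =
        Y.toDual y ⟨W.conjH1 p κ.kerSubgroup γ s, W.conjH1_mem_fineSelmerInfty κ γ s.2⟩ - Y.toDual y s :=
      fun y ↦ by
        rw [hψ, IwasawaDual.End_sub_apply, AddMonoid.End.one_apply, map_sub]
        rfl
    set g : IwasawaAlgebra p := PowerSeries.mk fun n ↦ PowerSeries.coeff (n + 1) f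
    set a : ℤ_[p] := PowerSeries.constantCoeff f
    have hf : f = PowerSeries.X * g + PowerSeries.C a := PowerSeries.eq_X_mul_shift_add_const f
    have lhs : Y.toDual (f • x) s =
        Y.toDual (g • x) (ψ s) + (PadicInt.toZModPow k a).val • Y.toDual x s := by
      conv_lhs => rw [hf]
      rw [add_smul, mul_smul, map_add, AddMonoidHom.add_apply, Y.toDual_T_smul,
        Y.toDual_C_smul a x s k hk, hψeval]
    have rhs : h.smulFun f (Y.toDual x) s =
        h.smulFun g (Y.toDual x) (ψ s) + (PadicInt.toZModPow k a).val • Y.toDual x s := by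
      conv_lhs => rw [hf]
      rw [h.smulFun_add_left, h.smulFun_mul_left, AddMonoidHom.add_apply, h.smulFun_X_apply,
        h.smulFun_C_apply a (Y.toDual x) hk]
    rw [lhs, rhs, ih (ψ s) hψs g x]

/-- **The `Λ`-action of a `FineSelmerDualData` is forced**: for ANY pinned datum `Y` of `X₀(E/K_∞)`, all `f ∈ Λ` and
`x ∈ Y.X`, `Y.toDual (f • x) = f ⋆ Y.toDual x` with `⋆` the canonical action attached to `conj_γ − 1` on
`Hom(Sel₀(K_∞), ℚ/ℤ)` (every class is killed by a power of `p` and of `conj_γ − 1`,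
`isLocNil_conjFineSelmerInfty_sub_one`). [cite: GreenbergLNM1716, §1 (after Conj. 1.3)] -/
theorem fineDual_toDual_smul (hγ : κ.IsTopGenerator γ) (Y : W.FineSelmerDualData κ γ) (f : IwasawaAlgebra p)
    (x : Y.X) :
    Y.toDual (f • x) = (W.isLocNil_conjFineSelmerInfty_sub_one κ hγ).smulFun f (Y.toDual x) := by
  ext s
  obtain ⟨N, hN⟩ := (W.isLocNil_conjFineSelmerInfty_sub_one κ hγ).nil s
  exact fineDual_toDual_smul_apply_of_pow_apply_eq_zero W κ hγ Y N s hN f x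

/-! ## §2 The inclusion `Sel₀(K_∞) ↪ Sel^ε(E/K_∞)` intertwines `conj_γ` -/

variable [W.IsElliptic]

/-- The inclusion `ι₀ : Sel₀(K_∞, E[p^∞]) → Sel^ε(E/K_∞)` (`fineSelmerInfty_le_signedSelmerInfty`) commutes with
`conj_γ` (both are restrictions of `conj_γ` on `H¹(K_∞, E[p^∞])`). [cite: Kobayashi2003, Def. 1.1 (p. 2)] -/
theorem inclusion_conjFineSelmerInfty (γ : Field.absoluteGaloisGroup K) (s : W.fineSelmerInfty κ) :
    AddSubgroup.inclusion (fineSelmerInfty_le_signedSelmerInfty W κ ε) (W.conjFineSelmerInfty κ γ s) =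
      conjSignedSelmerInfty W κ ε γ (AddSubgroup.inclusion (fineSelmerInfty_le_signedSelmerInfty W κ ε) s) :=
  Subtype.ext rfl

/-- `ι₀` intertwines `ψ₀ = conj_γ − 1` on `Sel₀` with `ψ = conj_γ − 1` on `Sel^ε`. [cite: Kobayashi2003, Def. 1.1 (p. 2)] -/
theorem inclusion_conjFineSelmerInfty_sub_one (γ : Field.absoluteGaloisGroup K) (s : W.fineSelmerInfty κ) :
    AddSubgroup.inclusion (fineSelmerInfty_le_signedSelmerInfty W κ ε) ((W.conjFineSelmerInfty κ γ - 1) s) =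
      (conjSignedSelmerInfty W κ ε γ - 1)
        (AddSubgroup.inclusion (fineSelmerInfty_le_signedSelmerInfty W κ ε) s) := by
  rw [IwasawaDual.End_sub_apply, IwasawaDual.End_sub_apply, AddMonoid.End.one_apply, AddMonoid.End.one_apply,
    map_sub, inclusion_conjFineSelmerInfty]

/-! ## §3 Existence and uniqueness of the restriction `k : X^ε ↠ X₀` on the pinned duals -/

variable {ε}

/-- **The restriction map exists.** For a topological generator `γ`, any pinned `D : SignedSelmerDualData W κ γ ε` and
`Y : W.FineSelmerDualData κ γ`, there is a `Λ`-LINEAR `k : D.X → Y.X` with `Y.toDual (k x) = (D.toDual x) ∘ ι₀` —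
the Pontryagin dual `X^ε(E/K_∞) → X₀(E/K_∞)` of `Sel₀ ≤ Sel^ε` (Kobayashi (7.17)/(7.21): `X^± → X₀`), read on K3's
interfaces. `Λ`-linearity: both actions are the canonical ones (`SignedSelmerDualData.toDual_smul`,
`fineDual_toDual_smul`), which are natural along `ι₀` (`IsLocNil.smulFun_comp`).
[cite: Kobayashi2003, (7.17) and Thm. 7.3 (7.21) (pp. 12–13)] [cite: GreenbergLNM1716, §1 (after Conj. 1.3)] -/
theorem exists_fineRestrict (hγ : κ.IsTopGenerator γ) (D : SignedSelmerDualData W κ γ ε)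
    (Y : W.FineSelmerDualData κ γ) :
    ∃ k : D.X →ₗ[IwasawaAlgebra p] Y.X, ∀ (x : D.X) (s : W.fineSelmerInfty κ),
      Y.toDual (k x) s = D.toDual x (AddSubgroup.inclusion (fineSelmerInfty_le_signedSelmerInfty W κ ε) s) := by
  set ι₀ : W.fineSelmerInfty κ →+ signedSelmerInfty W κ ε :=
    AddSubgroup.inclusion (fineSelmerInfty_le_signedSelmerInfty W κ ε) with hι₀
  set eY := AddEquiv.ofBijective Y.toDual Y.bijective with heY
  have heY_apply : ∀ χ, Y.toDual (eY.symm χ) = χ := fun χ ↦ eY.apply_symm_apply χ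
  refine ⟨{ toFun := fun x ↦ eY.symm ((D.toDual x).comp ι₀)
            map_add' := fun x y ↦ by rw [map_add, AddMonoidHom.add_comp, map_add]
            map_smul' := fun f x ↦ ?_ }, fun x s ↦ ?_⟩
  · apply Y.bijective.injective
    rw [RingHom.id_apply, heY_apply, fineDual_toDual_smul W κ hγ Y, heY_apply, D.toDual_smul,
      IsLocNil.smulFun_comp (W.isLocNil_conjFineSelmerInfty_sub_one κ hγ)
        (isLocNil_conjSignedSelmerInfty_sub_one' W κ ε γ) ι₀
        (fun s ↦ inclusion_conjFineSelmerInfty_sub_one W κ ε γ s)]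
  · show Y.toDual (eY.symm ((D.toDual x).comp ι₀)) s = _
    rw [heY_apply, AddMonoidHom.comp_apply]

/-- **Uniqueness**: two `k`'s compatible with the `toDual`'s agree (`Y.toDual` is injective). [folklore] -/
theorem fineRestrict_unique (D : SignedSelmerDualData W κ γ ε) (Y : W.FineSelmerDualData κ γ)
    (k k' : D.X →ₗ[IwasawaAlgebra p] Y.X)
    (hk : ∀ (x : D.X) (s : W.fineSelmerInfty κ),
      Y.toDual (k x) s = D.toDual x (AddSubgroup.inclusion (fineSelmerInfty_le_signedSelmerInfty W κ ε) s))
    (hk' : ∀ (x : D.X) (s : W.fineSelmerInfty κ),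
      Y.toDual (k' x) s = D.toDual x (AddSubgroup.inclusion (fineSelmerInfty_le_signedSelmerInfty W κ ε) s)) :
    k = k' := by
  refine LinearMap.ext fun x ↦ Y.bijective.injective (AddMonoidHom.ext fun s ↦ ?_)
  rw [hk, hk']

/-! ## §4 Properties of the restriction: onto, kernel, lengths, torsion -/

/-- **`k : X^ε ↠ X₀` is ONTO**: every character of `Sel₀(K_∞)` extends to `Sel^ε(E/K_∞)` along the injective `ι₀`,
because `ℚ/ℤ` is divisible (Mathlib: `CharacterModule.dual_surjective_of_injective`, Baer). This is the surjectivity of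
`X^±(E/K_n) → X₀(E/K_n)` in Kobayashi's (7.17)/(7.21). [cite: Kobayashi2003, (7.17) and (7.21) (pp. 12–13)] -/
theorem fineRestrict_surjective (D : SignedSelmerDualData W κ γ ε) (Y : W.FineSelmerDualData κ γ)
    (k : D.X →ₗ[IwasawaAlgebra p] Y.X)
    (hk : ∀ (x : D.X) (s : W.fineSelmerInfty κ),
      Y.toDual (k x) s = D.toDual x (AddSubgroup.inclusion (fineSelmerInfty_le_signedSelmerInfty W κ ε) s)) :
    Function.Surjective k := by
  intro y
  set ι₀ : W.fineSelmerInfty κ →+ signedSelmerInfty W κ ε :=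
    AddSubgroup.inclusion (fineSelmerInfty_le_signedSelmerInfty W κ ε) with hι₀
  have hinj : Function.Injective ι₀.toIntLinearMap :=
    AddSubgroup.inclusion_injective (fineSelmerInfty_le_signedSelmerInfty W κ ε)
  -- extend the character `Y.toDual y` of `Sel₀` to `Sel^ε`
  obtain ⟨L, hL⟩ := CharacterModule.dual_surjective_of_injective (R := ℤ) ι₀.toIntLinearMap hinj
    (Y.toDual y : CharacterModule (W.fineSelmerInfty κ))
  obtain ⟨x, hx⟩ := D.bijective.surjective (L : signedSelmerInfty W κ ε →+ AddCircle (1 : ℚ))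
  refine ⟨x, Y.bijective.injective (AddMonoidHom.ext fun s ↦ ?_)⟩
  rw [hk, hx]
  have := congrArg (fun χ : CharacterModule (W.fineSelmerInfty κ) ↦ χ s) hL
  simp only [CharacterModule.dual_apply] at this
  exact this

/-- **The kernel of `k`**: `k x = 0` iff the character `D.toDual x` of `Sel^ε(E/K_∞)` VANISHES ON `Sel₀(K_∞, E[p^∞])` —
so `ker k` is the Pontryagin dual of `Sel^ε/Sel₀`, the group cut out by the local condition at `p` (Kobayashi: the
image of `H¹(k_n,T)/H¹_±` in (7.17)). [cite: Kobayashi2003, (7.17) and (7.21) (pp. 12–13)] -/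
theorem fineRestrict_eq_zero_iff (D : SignedSelmerDualData W κ γ ε) (Y : W.FineSelmerDualData κ γ)
    (k : D.X →ₗ[IwasawaAlgebra p] Y.X)
    (hk : ∀ (x : D.X) (s : W.fineSelmerInfty κ),
      Y.toDual (k x) s = D.toDual x (AddSubgroup.inclusion (fineSelmerInfty_le_signedSelmerInfty W κ ε) s))
    (x : D.X) :
    k x = 0 ↔ ∀ s : W.fineSelmerInfty κ,
      D.toDual x (AddSubgroup.inclusion (fineSelmerInfty_le_signedSelmerInfty W κ ε) s) = 0 := by
  constructor
  · intro h s
    rw [← hk, h, map_zero, AddMonoidHom.zero_apply]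
  · intro h
    have h0 : Y.toDual (k x) = Y.toDual 0 := by
      rw [map_zero]
      exact AddMonoidHom.ext fun s ↦ by rw [hk, h, AddMonoidHom.zero_apply]
    exact Y.bijective.injective h0

/-- Membership form of the kernel description. [cite: Kobayashi2003, (7.17) and (7.21) (pp. 12–13)] -/
theorem mem_ker_fineRestrict_iff (D : SignedSelmerDualData W κ γ ε) (Y : W.FineSelmerDualData κ γ)
    (k : D.X →ₗ[IwasawaAlgebra p] Y.X)
    (hk : ∀ (x : D.X) (s : W.fineSelmerInfty κ),
      Y.toDual (k x) s = D.toDual x (AddSubgroup.inclusion (fineSelmerInfty_le_signedSelmerInfty W κ ε) s))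
    (x : D.X) :
    x ∈ LinearMap.ker k ↔ ∀ s : W.fineSelmerInfty κ,
      D.toDual x (AddSubgroup.inclusion (fineSelmerInfty_le_signedSelmerInfty W κ ε) s) = 0 := by
  rw [LinearMap.mem_ker, fineRestrict_eq_zero_iff W κ D Y k hk]

/-- **Length bookkeeping**: `ℓ_𝔭(X^ε) = ℓ_𝔭(ker k) + ℓ_𝔭(X₀)` at every prime `𝔭` of `Λ` (additivity of local lengths on
`0 → ker k → D.X → Y.X → 0`). With the four-term inequality this is where «`ℓ_𝔭(X⁺) ≤ ℓ_𝔭(X₀) + ℓ_𝔭(im j)`» comes from.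
[cite: Kobayashi2003, (7.21) and proof of Thm. 7.4 (p. 13)] -/
theorem lengthAt_eq_lengthAt_ker_fineRestrict_add (D : SignedSelmerDualData W κ γ ε) (Y : W.FineSelmerDualData κ γ)
    (k : D.X →ₗ[IwasawaAlgebra p] Y.X)
    (hk : ∀ (x : D.X) (s : W.fineSelmerInfty κ),
      Y.toDual (k x) s = D.toDual x (AddSubgroup.inclusion (fineSelmerInfty_le_signedSelmerInfty W κ ε) s))
    (𝔭 : PrimeSpectrum (IwasawaAlgebra p)) :
    lengthAt (IwasawaAlgebra p) D.X 𝔭 =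
      lengthAt (IwasawaAlgebra p) (LinearMap.ker k) 𝔭 + lengthAt (IwasawaAlgebra p) Y.X 𝔭 :=
  lengthAt_eq_add_of_exact (LinearMap.ker k).subtype k (Submodule.injective_subtype _)
    (fineRestrict_surjective W κ D Y k hk) (LinearMap.exact_subtype_ker_map k) 𝔭

/-- `ℓ_𝔭(X₀) ≤ ℓ_𝔭(X^ε)` for every prime `𝔭` of `Λ` (the restriction is onto). [cite: Kobayashi2003, (7.21) (p. 13)] -/
theorem lengthAt_fine_le_lengthAt_signed (hγ : κ.IsTopGenerator γ) (D : SignedSelmerDualData W κ γ ε)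
    (Y : W.FineSelmerDualData κ γ) (𝔭 : PrimeSpectrum (IwasawaAlgebra p)) :
    lengthAt (IwasawaAlgebra p) Y.X 𝔭 ≤ lengthAt (IwasawaAlgebra p) D.X 𝔭 := by
  obtain ⟨k, hk⟩ := exists_fineRestrict W κ hγ D Y
  exact lengthAt_le_of_surjective k (fineRestrict_surjective W κ D Y k hk) 𝔭

/-- **`X₀(E/K_∞)` is `Λ`-torsion whenever `X^ε(E/K_∞)` is** (image of a torsion module under the onto `Λ`-linear
`k`): on K3's habitat the torsion hypothesis on `D.X` already covers `Y.X`. [cite: Kobayashi2003, Cor. 7.2 and (7.21) (p. 13)] -/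
theorem isTorsion_fine_of_isTorsion_signed (hγ : κ.IsTopGenerator γ) (D : SignedSelmerDualData W κ γ ε)
    (Y : W.FineSelmerDualData κ γ) (hD : Module.IsTorsion (IwasawaAlgebra p) D.X) :
    Module.IsTorsion (IwasawaAlgebra p) Y.X := by
  obtain ⟨k, hk⟩ := exists_fineRestrict W κ hγ D Y
  intro y
  obtain ⟨x, rfl⟩ := fineRestrict_surjective W κ D Y k hk y
  obtain ⟨a, ha⟩ := @hD x
  have ha' : (a : IwasawaAlgebra p) • x = 0 := ha
  exact ⟨a, show (a : IwasawaAlgebra p) • k x = 0 by rw [← map_smul, ha', map_zero]⟩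

/-! ## §5 The package form -/

/-- **The (PT) Selmer side on the pinned duals, packaged**: for `γ` a topological generator and ANY pinned
`D : SignedSelmerDualData W κ γ ε`, `Y : W.FineSelmerDualData κ γ` there is a `Λ`-linear `k : D.X → Y.X`, compatible
with the `toDual`'s along `Sel₀ ≤ Sel^ε`, ONTO, with `ker k = {x | D.toDual x vanishes on Sel₀}` and
`ℓ_𝔭(D.X) = ℓ_𝔭(ker k) + ℓ_𝔭(Y.X)` for all `𝔭` — the `k` of `SignedKatoOffTwo.fourTerm_lengthAt_le_upTo`.
[cite: Kobayashi2003, (7.17), (7.21), Thm. 7.3 (pp. 12–13)] [cite: GreenbergLNM1716, §1 (after Conj. 1.3)] -/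
theorem exists_fineRestrict_package (hγ : κ.IsTopGenerator γ) (D : SignedSelmerDualData W κ γ ε)
    (Y : W.FineSelmerDualData κ γ) :
    ∃ k : D.X →ₗ[IwasawaAlgebra p] Y.X,
      (∀ (x : D.X) (s : W.fineSelmerInfty κ),
        Y.toDual (k x) s = D.toDual x (AddSubgroup.inclusion (fineSelmerInfty_le_signedSelmerInfty W κ ε) s)) ∧
      Function.Surjective k ∧
      (∀ x : D.X, k x = 0 ↔ ∀ s : W.fineSelmerInfty κ,
        D.toDual x (AddSubgroup.inclusion (fineSelmerInfty_le_signedSelmerInfty W κ ε) s) = 0) ∧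
      ∀ 𝔭 : PrimeSpectrum (IwasawaAlgebra p),
        lengthAt (IwasawaAlgebra p) D.X 𝔭 =
          lengthAt (IwasawaAlgebra p) (LinearMap.ker k) 𝔭 + lengthAt (IwasawaAlgebra p) Y.X 𝔭 := by
  obtain ⟨k, hk⟩ := exists_fineRestrict W κ hγ D Y
  exact ⟨k, hk, fineRestrict_surjective W κ D Y k hk, fun x ↦ fineRestrict_eq_zero_iff W κ D Y k hk x,
    fun 𝔭 ↦ lengthAt_eq_lengthAt_ker_fineRestrict_add W κ D Y k hk 𝔭⟩

end SignedKatoOffTwo.FineRestriction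

end Summit.BirchSwinnertonDyer.BirchSwinnertonDyer.Theorems

end
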